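import Mathlib
import HarnessLib
import Literature.Analysis.FluidPDE.SelfSimilar
import Literature.Analysis.FluidPDE.SelfSimilarLiouville
import Literature.Analysis.FluidPDE.KNSSAxisymmetricNoSwirlHolds
import Literature.Analysis.FluidPDE.LocalTypeI
import Literature.Analysis.FluidPDE.VectorCalculus
import Literature.Analysis.FluidPDE.AxisymmetricEuler
import Literature.Analysis.FluidPDE.SwirlTransportProofs
import Literature.Analysis.FluidPDE.AxisymmetricVorticityTransport
import Literature.Analysis.FluidPDE.TypeIAncientMild
import Literature.Analysis.FluidPDE.KatoSymmetryCovariance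
import Literature.Analysis.FluidPDE.KNSSOseenMildDecayTools
import Literature.Analysis.FluidPDE.TaoEnstrophyLocalisation
import Literature.Analysis.UnboundedOperators.HeatKernel
import Summits.NavierStokesRegularity.NavierStokesRegularity.Theorems.LocalSineTubeDoorProfileAlignedWindowRigidityAncient
import Summits.NavierStokesRegularity.NavierStokesRegularity.Theorems.PoloidalWindowDoorPoloidalWindowRigidityWindow
import Summits.NavierStokesRegularity.NavierStokesRegularity.Theorems.PoloidalWindowDoorPoloidalWindowRigidityFlat

/-!
# Route `PoloidalWindowDoor` (staged, nsreg-p1), crux `PoloidalWindowRigidity` — the AXISYMMETRIC sub-stratum of the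
# open stub `stub_nonflatLiouville` (nsreg-p1 ROUND-8 rungs (R8-c)/(R8-c′), KNSS 2009 Thm 5.2)

Cell ns-regularity-ideate, seat p6 (route-directed support; land `--supports <PoloidalWindowRigidity item>` once the
route is born). After the four proved stubs of the K2 birth skeleton the open residue is `stub_nonflatLiouville`
(a Type-I profile of the route's class, poloidal along `e₃`, with the frozen constraint and a non-flat first
integral, is not backward-singular). The planner's ROUND-9 programme (R9-PREP §2, conjecture LRC-rc) splits it as
«poloidal + rotational + non-flat ⟹ axisymmetric about a vertical axis» ∘ «axisymmetric & poloidal along the axis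
⟹ not backward-singular». This file is the SECOND factor as a tree theorem, with exactly the class hypotheses of
the skeleton (no cell structure `IsTypeIProfile`):

* `inner_fderiv_comm_of_curl_two_eq_zero` — `ω₃ = 0` is the symmetry of the horizontal block of `Dv`;
* `hasNoSwirl_of_isAxisymmetric_of_curl_two_eq_zero` — (R8-c) a differentiable axisymmetric field with `ω₃ ≡ 0`
  has no swirl (the identity `ω_z = r⁻¹∂_r(r u_θ)` without division by `r`: `∂ₗ Γ(c + l h) = 0` along horizontal
  rays from the axis, `Γ = 0` on the axis);
* `not_backwardSingular_of_axisymmetric_noSwirl` — a profile of the route's class with axisymmetric swirl-free slices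
  is not backward-singular: the time-shifted field is a bounded ancient mild solution
  (`IsTypeIAncientMild.isBoundedAncientMildSolution_sub`), KNSS 2009 Thm 5.2 (tree THEOREM
  `knss_axisymmetric_no_swirl'_holds`) makes every slice constant, and the Type-I gauge kills constants
  (`IsTypeIAncientMild.eq_zero_of_slice_const`);
* `eq_zero_of_axisymmetric_noSwirl` — in fact such a profile vanishes identically;
* `nonflatLiouville_of_axisymmetric` — (R8-c′) the axisymmetric sub-stratum of `stub_nonflatLiouville`: class +
  poloidal along `e₃` + axisymmetric slices ⟹ not backward-singular (the frozen-constraint and non-flatness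
  hypotheses of the stub are not needed on this stratum);
* `class_translate`, `nonflatLiouville_of_axisymmetric_translate` — the same for slices axisymmetric about ANY
  vertical axis `a + ℝe₃` (translation covariance of the class: `heatExtension_comp_add_right`,
  `oseenDuhamel_comp_add_right`); the profile then vanishes identically, so no point is singular.

WHAT THIS IS NOT: not a claim about Navier–Stokes regularity and not the open stub — the settled axisymmetric
stratum of it, for a STAGED door route (bears_on LADDER-NS N0, rung N0-LocalTubeDoorPoloidal).
-/

noncomputable section

-- the summit and its single sub-problem share the name (CONVENTIONS §1), as in every Theorems file
set_option linter.dupNamespace false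

namespace Summit.NavierStokesRegularity.NavierStokesRegularity.Theorems.PoloidalWindowDoorPoloidalWindowRigidityAxisymmetric

open MeasureTheory Set Function Filter Topology TopologicalSpace Metric
open scoped RealInnerProductSpace InnerProductSpace
open Literature.Analysis Literature.Analysis.FluidPDE
open Summit.NavierStokesRegularity.NavierStokesRegularity.Theorems.LocalSineTubeDoorProfileAlignedWindowRigidityAncient
open Summit.NavierStokesRegularity.NavierStokesRegularity.Theorems.PoloidalWindowDoorPoloidalWindowRigidityWindow
open Summit.NavierStokesRegularity.NavierStokesRegularity.Theorems.PoloidalWindowDoorPoloidalWindowRigidityFlat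

/-- `ω₃ = 0` is the symmetry of the horizontal block of `DV`: for horizontal `k₁, k₂`,
`⟪k₁, DV(z) k₂⟫ = ⟪DV(z) k₁, k₂⟫` (port of nsreg-p1 Sketch8A (R8-c)). -/
theorem inner_fderiv_comm_of_curl_two_eq_zero {V : EuclideanSpace ℝ (Fin 3) → EuclideanSpace ℝ (Fin 3)}
    {z : EuclideanSpace ℝ (Fin 3)} (hz : curl V z 2 = 0) {k₁ k₂ : EuclideanSpace ℝ (Fin 3)} (h₁ : k₁ 2 = 0)
    (h₂ : k₂ 2 = 0) : ⟪k₁, fderiv ℝ V z k₂⟫_ℝ = ⟪fderiv ℝ V z k₁, k₂⟫_ℝ := by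
  set A : EuclideanSpace ℝ (Fin 3) →L[ℝ] EuclideanSpace ℝ (Fin 3) := fderiv ℝ V z with hA
  have hc : A (EuclideanSpace.single 0 1) 1 = A (EuclideanSpace.single 1 1) 0 := by
    have := hz
    simp only [curl, PiLp.toLp_apply, Matrix.cons_val_two, Matrix.tail_cons,
      Matrix.head_cons] at this
    linarith
  rw [clm_apply_eq_sum A k₁, clm_apply_eq_sum A k₂]
  simp only [PiLp.inner_apply, RCLike.inner_apply, conj_trivial, Fin.sum_univ_three,
    PiLp.add_apply, PiLp.smul_apply, smul_eq_mul, h₁, h₂]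
  linear_combination (k₂ 0 * k₁ 1 - k₁ 0 * k₂ 1) * hc

/-- **(R8-c) Containment: a differentiable axisymmetric field with `ω₃ ≡ 0` has no swirl.** Along every horizontal ray
`γ(l) = c + l h` from an axis point `c`, `∂ₗ Γ(γ(l)) = ⟪J γ, DV h⟫ + ⟪J h, V⟫ = l⟪DV (Jh), h⟫ + ⟪Jh, V⟫ = ⟪J V, h⟫ + ⟪J h, V⟫ = 0`
(symmetry of the horizontal block = `ω₃ = 0`; infinitesimal axisymmetry `DV (J y) = J V`), and `Γ = x₀V₁ − x₁V₀ = 0`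
on the axis — the identity `ω_z = r⁻¹∂_r(r u_θ)` without division by `r` (port of nsreg-p1 Sketch8A (R8-c)). -/
theorem hasNoSwirl_of_isAxisymmetric_of_curl_two_eq_zero {V : EuclideanSpace ℝ (Fin 3) → EuclideanSpace ℝ (Fin 3)}
    (hd : Differentiable ℝ V) (hax : IsAxisymmetric V) (hω : ∀ y, curl V y 2 = 0) : HasNoSwirl V := by
  intro y
  -- the horizontal part `h` of `y`, the axis point `c`, the ray `γ l = c + l • h`
  set h : EuclideanSpace ℝ (Fin 3) := WithLp.toLp 2 ![y 0, y 1, 0] with hh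
  set c : EuclideanSpace ℝ (Fin 3) := WithLp.toLp 2 ![0, 0, y 2] with hc
  have h2 : h 2 = 0 := by simp [hh]
  have hJ2 : rotGen h 2 = 0 := rotGen_apply_two h
  set γ : ℝ → EuclideanSpace ℝ (Fin 3) := fun l => c + l • h with hγ
  have hγrot : ∀ l : ℝ, rotGen (γ l) = l • rotGen h := fun l => by
    ext i
    fin_cases i <;> simp [hγ, hc, hh, rotGen]
  have hderiv : ∀ l : ℝ, HasDerivAt (fun l => swirl V (γ l)) 0 l := by
    intro l
    have hline : HasDerivAt γ h l := by
      simpa [hγ] using ((hasDerivAt_id l).smul_const h).const_add c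
    have hcomp := (differentiableAt_swirl (hd (γ l))).hasFDerivAt.comp_hasDerivAt l hline
    have hax' := hax.fderiv_rotGen (hd (γ l))
    rw [hγrot, map_smul] at hax'
    have hval : fderiv ℝ (swirl V) (γ l) h = 0 := by
      rw [fderiv_swirl_apply (hd (γ l)) h, hγrot, real_inner_smul_left,
        inner_fderiv_comm_of_curl_two_eq_zero (hω (γ l)) hJ2 h2]
      have : l * ⟪fderiv ℝ V (γ l) (rotGen h), h⟫_ℝ = ⟪rotGen (V (γ l)), h⟫_ℝ := by
        rw [← hax', real_inner_smul_left]
      rw [this, inner_rotGen_left_eq_neg (V (γ l)) h, real_inner_comm (V (γ l)) (rotGen h)]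
      ring
    simpa [hval, Function.comp_def] using hcomp
  have hconst := is_const_of_deriv_eq_zero (f := fun l => swirl V (γ l))
    (fun l => (hderiv l).differentiableAt) (fun l => (hderiv l).deriv) 1 0
  have hγ1 : γ 1 = y := by
    ext i
    fin_cases i <;> simp [hγ, hc, hh]
  have hγ0 : swirl V (γ 0) = 0 := by simp [hγ, hc, swirl]
  simpa [hγ1, hγ0] using hconst

variable {C : ℝ} {v : ℝ → EuclideanSpace ℝ (Fin 3) → EuclideanSpace ℝ (Fin 3)}

/-- **The swirl-free axisymmetric stratum is trivial** (KNSS 2009 Thm 5.2, tree THEOREM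
`knss_axisymmetric_no_swirl'_holds`): a profile of the route's Type-I class with axisymmetric swirl-free slices has
constant slices (KNSS, applied to the time-shifted bounded ancient mild solution
`IsTypeIAncientMild.isBoundedAncientMildSolution_sub`), hence vanishes identically (the Type-I gauge kills constants,
`IsTypeIAncientMild.eq_zero_of_slice_const`) (port of nsreg-p1 Sketch8A `poloidalRigidity_rung_noSwirl`). -/
theorem eq_zero_of_axisymmetric_noSwirl (hrate : HasTypeITimeDecay C v)
    (hcont : ContinuousOn (uncurry v) (Iio (0 : ℝ) ×ˢ univ))
    (hmild : ∀ s t : ℝ, s < t → t < 0 → ∀ x,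
      v t x = UnboundedOperators.heatExtension (v s) (t - s) x - oseenDuhamel 1 s v v t x)
    (hdiv : ∀ t < 0, VectorCalculus.IsDivFree (v t))
    (haxi : ∀ s < 0, IsAxisymmetric (v s)) (hsw : ∀ s < 0, HasNoSwirl (v s)) :
    ∀ t < 0, ∀ x, v t x = 0 := by
  have hA : IsTypeIAncientMild C v := isTypeIAncientMild_of_class hrate hcont hmild hdiv
  have hconst : ∀ t < 0, ∀ x, v t x = v t 0 := by
    intro t ht x
    obtain ⟨δ, hδ0, hδt⟩ : ∃ δ : ℝ, 0 < δ ∧ t + δ < 0 := ⟨-t / 2, by linarith, by linarith⟩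
    have hw : IsBoundedAncientMildSolution 1 (fun τ => v (τ - δ)) :=
      hA.isBoundedAncientMildSolution_sub hδ0
    have hmeas : ∀ τ < 0, AEStronglyMeasurable ((fun τ => v (τ - δ)) τ) volume :=
      fun τ hτ => (continuous_slice hcont (by linarith : τ - δ < 0)).aestronglyMeasurable
    have haxi' : ∀ τ < 0, IsAxisymmetric ((fun τ => v (τ - δ)) τ) :=
      fun τ hτ => haxi _ (by linarith)
    have hsw' : ∀ τ < 0, HasNoSwirl ((fun τ => v (τ - δ)) τ) := fun τ hτ => hsw _ (by linarith)
    obtain ⟨b, hb⟩ := knss_axisymmetric_no_swirl'_holds hw hmeas haxi' hsw' (t + δ) hδt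
    have hb' : v t =ᵐ[volume] fun _ => b := by simpa only [add_sub_cancel_right] using hb
    have hct : Continuous (v t) := continuous_slice hcont ht
    have heq : v t = fun _ => b := (Continuous.ae_eq_iff_eq (μ := volume) hct continuous_const).1 hb'
    rw [heq]
  exact fun t ht y => hA.eq_zero_of_slice_const (b := fun t => v t 0) (fun t ht x => hconst t ht x) ht y

/-- **The swirl-free axisymmetric stratum is not backward-singular** (corollary of
`eq_zero_of_axisymmetric_noSwirl`). -/
theorem not_backwardSingular_of_axisymmetric_noSwirl (hrate : HasTypeITimeDecay C v)
    (hcont : ContinuousOn (uncurry v) (Iio (0 : ℝ) ×ˢ univ))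
    (hmild : ∀ s t : ℝ, s < t → t < 0 → ∀ x,
      v t x = UnboundedOperators.heatExtension (v s) (t - s) x - oseenDuhamel 1 s v v t x)
    (hdiv : ∀ t < 0, VectorCalculus.IsDivFree (v t))
    (haxi : ∀ s < 0, IsAxisymmetric (v s)) (hsw : ∀ s < 0, HasNoSwirl (v s)) :
    ¬ IsBackwardSingularPoint v 0 :=
  not_backwardSingular_of_zero (eq_zero_of_axisymmetric_noSwirl hrate hcont hmild hdiv haxi hsw)

/-- **(R8-c′) The axisymmetric sub-stratum of the open stub `stub_nonflatLiouville` is settled.** A profile of the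
route's Type-I class (Type-I time rate, continuity on the open lower slab, unit-viscosity Oseen–Duhamel identity,
divergence-free slices) which is poloidal along `e₃` (`⟪curl v(s), e₃⟫ ≡ 0`) and has axisymmetric slices (about the
`e₃`-axis) is not backward-singular at the apex: `ω₃ ≡ 0` & axisymmetric ⟹ swirl-free
(`hasNoSwirl_of_isAxisymmetric_of_curl_two_eq_zero`, slices are smooth by Oseen-ancient analyticity) ⟹ KNSS 2009
Thm 5.2 (`not_backwardSingular_of_axisymmetric_noSwirl`). -/
theorem nonflatLiouville_of_axisymmetric (hrate : HasTypeITimeDecay C v)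
    (hcont : ContinuousOn (uncurry v) (Iio (0 : ℝ) ×ˢ univ))
    (hmild : ∀ s t : ℝ, s < t → t < 0 → ∀ x,
      v t x = UnboundedOperators.heatExtension (v s) (t - s) x - oseenDuhamel 1 s v v t x)
    (hdiv : ∀ t < 0, VectorCalculus.IsDivFree (v t))
    (hpol : ∀ s < 0, ∀ y, ⟪curl (v s) y, EuclideanSpace.single 2 1⟫_ℝ = 0)
    (haxi : ∀ s < 0, IsAxisymmetric (v s)) : ¬ IsBackwardSingularPoint v 0 := by
  refine not_backwardSingular_of_axisymmetric_noSwirl hrate hcont hmild hdiv haxi fun s hs => ?_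
  have hC : ContDiff ℝ 1 (v s) := (analyticOnNhd_slice hcont (bdd_of_hasTypeITimeDecay hrate) hmild hs).contDiff
  refine hasNoSwirl_of_isAxisymmetric_of_curl_two_eq_zero (hC.differentiable one_ne_zero) (haxi s hs) fun y => ?_
  simpa [EuclideanSpace.inner_single_right] using hpol s hs y

/-- Smooth slices: `ω₃ ≡ 0` & axisymmetric ⟹ swirl-free, for a profile of the class (slices are real-analytic). -/
theorem hasNoSwirl_of_poloidal_axisymmetric (hrate : HasTypeITimeDecay C v)
    (hcont : ContinuousOn (uncurry v) (Iio (0 : ℝ) ×ˢ univ))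
    (hmild : ∀ s t : ℝ, s < t → t < 0 → ∀ x,
      v t x = UnboundedOperators.heatExtension (v s) (t - s) x - oseenDuhamel 1 s v v t x)
    (hpol : ∀ s < 0, ∀ y, ⟪curl (v s) y, EuclideanSpace.single 2 1⟫_ℝ = 0)
    (haxi : ∀ s < 0, IsAxisymmetric (v s)) : ∀ s < 0, HasNoSwirl (v s) := by
  intro s hs
  have hC : ContDiff ℝ 1 (v s) := (analyticOnNhd_slice hcont (bdd_of_hasTypeITimeDecay hrate) hmild hs).contDiff
  refine hasNoSwirl_of_isAxisymmetric_of_curl_two_eq_zero (hC.differentiable one_ne_zero) (haxi s hs) fun y => ?_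
  simpa [EuclideanSpace.inner_single_right] using hpol s hs y

/-- **Translation covariance of the route's profile class**: for `a ∈ ℝ³` the translated field `v'(t,y) = v(t, y + a)`
keeps the Type-I time rate (same constant), continuity on the open lower slab, the unit-viscosity Oseen–Duhamel identity
(`heatExtension_comp_add_right`, `oseenDuhamel_comp_add_right`) and divergence-free slices. -/
theorem class_translate (a : EuclideanSpace ℝ (Fin 3)) (hrate : HasTypeITimeDecay C v)
    (hcont : ContinuousOn (uncurry v) (Iio (0 : ℝ) ×ˢ univ))
    (hmild : ∀ s t : ℝ, s < t → t < 0 → ∀ x,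
      v t x = UnboundedOperators.heatExtension (v s) (t - s) x - oseenDuhamel 1 s v v t x)
    (hdiv : ∀ t < 0, VectorCalculus.IsDivFree (v t)) :
    HasTypeITimeDecay C (fun t y => v t (y + a)) ∧
    ContinuousOn (uncurry fun t y => v t (y + a)) (Iio (0 : ℝ) ×ˢ univ) ∧
    (∀ s t : ℝ, s < t → t < 0 → ∀ x, (fun t y => v t (y + a)) t x =
      UnboundedOperators.heatExtension ((fun t y => v t (y + a)) s) (t - s) x -
        oseenDuhamel 1 s (fun t y => v t (y + a)) (fun t y => v t (y + a)) t x) ∧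
    (∀ t < 0, VectorCalculus.IsDivFree ((fun t y => v t (y + a)) t)) := by
  refine ⟨fun t ht y => hrate t ht (y + a), ?_, fun s t hst ht0 x => ?_, fun t ht y => ?_⟩
  · have h1 : ContinuousOn (fun p : ℝ × EuclideanSpace ℝ (Fin 3) => (p.1, p.2 + a)) (Iio (0 : ℝ) ×ˢ univ) :=
      (continuous_fst.prodMk (continuous_snd.add continuous_const)).continuousOn
    have h2 : MapsTo (fun p : ℝ × EuclideanSpace ℝ (Fin 3) => (p.1, p.2 + a)) (Iio (0 : ℝ) ×ˢ univ) (Iio 0 ×ˢ univ) :=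
      fun p hp => mem_prod.2 ⟨(mem_prod.1 hp).1, mem_univ _⟩
    exact hcont.comp h1 h2
  · show v t (x + a) = _
    rw [heatExtension_comp_add_right (v s) a (t - s) x, oseenDuhamel_comp_add_right 1 s v v a t x]
    exact hmild s t hst ht0 (x + a)
  · -- `div (v t ∘ (· + a)) (y) = div (v t) (y + a)`
    show VectorCalculus.divergence (fun y => v t (y + a)) y = 0
    have hD : fderiv ℝ (fun y => v t (y + a)) y = fderiv ℝ (v t) (y + a) := fderiv_comp_add_right a
    unfold VectorCalculus.divergence
    rw [hD]
    exact hdiv t ht (y + a)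

/-- **The axisymmetric sub-stratum about ANY vertical axis.** If a profile of the route's Type-I class is poloidal along
`e₃` and its slices are axisymmetric about the vertical axis through `a` (i.e. `y ↦ v(s, y + a)` is axisymmetric about
the `e₃`-axis for every `s < 0`), then the profile vanishes identically; in particular its apex `(0,0)` is not
backward-singular. -/
theorem nonflatLiouville_of_axisymmetric_translate (a : EuclideanSpace ℝ (Fin 3)) (hrate : HasTypeITimeDecay C v)
    (hcont : ContinuousOn (uncurry v) (Iio (0 : ℝ) ×ˢ univ))
    (hmild : ∀ s t : ℝ, s < t → t < 0 → ∀ x,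
      v t x = UnboundedOperators.heatExtension (v s) (t - s) x - oseenDuhamel 1 s v v t x)
    (hdiv : ∀ t < 0, VectorCalculus.IsDivFree (v t))
    (hpol : ∀ s < 0, ∀ y, ⟪curl (v s) y, EuclideanSpace.single 2 1⟫_ℝ = 0)
    (haxi : ∀ s < 0, IsAxisymmetric (fun y => v s (y + a))) :
    (∀ t < 0, ∀ x, v t x = 0) ∧ ¬ IsBackwardSingularPoint v 0 := by
  obtain ⟨hrate', hcont', hmild', hdiv'⟩ := class_translate a hrate hcont hmild hdiv
  have hpol' : ∀ s < 0, ∀ y, ⟪curl ((fun t y => v t (y + a)) s) y, EuclideanSpace.single 2 1⟫_ℝ = 0 := by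
    intro s hs y
    have hc : curl (fun y => v s (y + a)) y = curl (v s) (y + a) := by
      rw [curl_eq_curlCLM, curl_eq_curlCLM, fderiv_comp_add_right]
    show ⟪curl (fun y => v s (y + a)) y, EuclideanSpace.single 2 1⟫_ℝ = 0
    rw [hc]
    exact hpol s hs (y + a)
  have hzero' := eq_zero_of_axisymmetric_noSwirl hrate' hcont' hmild' hdiv' haxi
    (hasNoSwirl_of_poloidal_axisymmetric hrate' hcont' hmild' hpol' haxi)
  have hzero : ∀ t < 0, ∀ x, v t x = 0 := fun t ht x => by
    have h := hzero' t ht (x - a)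
    simpa only [sub_add_cancel] using h
  exact ⟨hzero, not_backwardSingular_of_zero hzero⟩

end Summit.NavierStokesRegularity.NavierStokesRegularity.Theorems.PoloidalWindowDoorPoloidalWindowRigidityAxisymmetric

end
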